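import Summits.NavierStokesRegularity.NavierStokesRegularity.Theorems.GaldiLiouvilleGateParabolicGaldiLiouvilleTightness
import HarnessLib

/-!
# Crux `ParabolicGaldiLiouville` (stmt-NavierStokesRegularity-0893), line `birth`, reshaping 2:
# the SHARP open stub `stub_sqIntegrableEnstrophy` still contains Galdi's Liouville problem

Helper file of the line lead (theorems only; no sorry, standard axioms), companion of
`GaldiLiouvilleGateParabolicGaldiLiouvilleTightness.lean`.

The reshaped line feeds Seregin's Liouville theorem at the Ladyzhenskaya–Prodi–Serrin exponents
`(s, l) = (6, 4)` — the weakest time requirement reachable from the `L^∞ ∩ L⁶ ∩ Ḣ¹` slices of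
the X2 class (`‖v(t)‖₆⁴ ≤ K⁴ E(t)²`, `E(t) = ∫|∇v(t)|_F²`) — so its one open stub asks only for a
SQUARE-INTEGRABLE enstrophy history `∫_{s<0} E(s)² ds < ∞` (threshold: the self-similar rate
`E ~ (−s)^{-1/2}`), instead of finite dissipation `∫ E < ∞`. This file records that the weakened
stub is nevertheless crux-sized:

* `Tightness.eq_zero_of_lintegral_frobeniusNormSq_eq_zero` — a `C¹` field on `ℝ³` tending to `0`
  at infinity with zero Dirichlet integral vanishes;
* `galdiLiouville_of_sqIntegrableEnstrophy : (statement of stub_sqIntegrableEnstrophy) → GaldiLiouville`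
  — a steady inhabitant (a D-solution with `ν` normalised to `1`, `Tightness.steady_hypotheses`)
  has constant enstrophy, whose square is integrable over `(−∞,0)` only if it is `0`.
-/

noncomputable section

set_option linter.dupNamespace false

namespace Summit.NavierStokesRegularity.NavierStokesRegularity.Theorems.ParabolicGaldiLiouville.Birth

open MeasureTheory Filter Topology Set Function Module Metric
open scoped ENNReal NNReal
open Literature.Analysis.FluidPDE

/-! ### The sharp gate (lead c1, reshaping 2): square-integrable enstrophy also contains Galdi -/

namespace Tightness

/-- **Zero Dirichlet integral forces a decaying `C¹` field to vanish.** If `W : ℝ³ → ℝ³` is `C¹`,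
tends to `0` at infinity and `∫ |∇W|_F² = 0`, then `W = 0`: the continuous nonnegative integrand
vanishes identically, so `DW ≡ 0` (`‖L‖² ≤ |L|_F²`), `W` is constant
(`is_const_of_fderiv_eq_zero`), and a constant tending to `0` is `0`. -/
theorem eq_zero_of_lintegral_frobeniusNormSq_eq_zero
    {W : EuclideanSpace ℝ (Fin 3) → EuclideanSpace ℝ (Fin 3)} (hW1 : ContDiff ℝ 1 W)
    (h0W : Tendsto W (cocompact (EuclideanSpace ℝ (Fin 3))) (𝓝 0))
    (hD0 : (∫⁻ y, ENNReal.ofReal (frobeniusNormSq (fderiv ℝ W y))) = 0) : ∀ y, W y = 0 := by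
  have hcont : Continuous fun y => ENNReal.ofReal (frobeniusNormSq (fderiv ℝ W y)) :=
    ENNReal.continuous_ofReal.comp (continuous_frobeniusNormSq_fderiv hW1 one_ne_zero)
  have hae : (fun y => ENNReal.ofReal (frobeniusNormSq (fderiv ℝ W y))) =ᵐ[volume] 0 :=
    (lintegral_eq_zero_iff hcont.measurable).1 hD0
  have hall : (fun y => ENNReal.ofReal (frobeniusNormSq (fderiv ℝ W y))) = fun _ => 0 :=
    (Continuous.ae_eq_iff_eq volume hcont continuous_const).1 hae
  have hfd : ∀ y, fderiv ℝ W y = 0 := fun y => by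
    have hy := congrFun hall y
    simp only [ENNReal.ofReal_eq_zero] at hy
    have hsq : ‖fderiv ℝ W y‖ ^ 2 ≤ 0 := (sq_opNorm_le_frobeniusNormSq _).trans hy
    have hn : ‖fderiv ℝ W y‖ = 0 := by nlinarith [norm_nonneg (fderiv ℝ W y)]
    exact norm_eq_zero.1 hn
  have hconst : ∀ y, W y = W 0 := fun y =>
    is_const_of_fderiv_eq_zero (hW1.differentiable one_ne_zero) hfd y 0
  have hW0 : W 0 = 0 := by
    have hc : Tendsto (fun _ : EuclideanSpace ℝ (Fin 3) => W 0)
        (cocompact (EuclideanSpace ℝ (Fin 3))) (𝓝 0) :=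
      h0W.congr (fun y => hconst y)
    exact tendsto_const_nhds_iff.1 hc
  exact fun y => (hconst y).trans hW0

end Tightness

/-- **The SHARP open stub of the line also contains Galdi's problem:
`stub_sqIntegrableEnstrophy → GaldiLiouville`.** The reshaped line (lead c1, cycle 2) feeds
Seregin's Liouville theorem at `(s, l) = (6, 4)` and therefore only asks for a SQUARE-INTEGRABLE
enstrophy history `∫_{s<0} (∫|∇v(s)|_F²)² ds < ∞` (weaker than finite dissipation; threshold at the
self-similar rate `(−s)^{-1/2}`). For the time-independent field `fun _ => W` built from a
D-solution (`W = ν⁻¹U`) the integrand is the constant `(∫|∇W|_F²)²` and `volume (Iio 0) = ∞`, so the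
stub forces `∫|∇W|_F² = 0`, whence `W = 0` (`Tightness.eq_zero_of_lintegral_frobeniusNormSq_eq_zero`)
and `U = 0`. The statement negated-free here is verbatim the registered stub
`stub_sqIntegrableEnstrophy` of crux stmt-NavierStokesRegularity-0893. -/
theorem galdiLiouville_of_sqIntegrableEnstrophy
    (hstub : ∀ v : ℝ → EuclideanSpace ℝ (Fin 3) → EuclideanSpace ℝ (Fin 3),
      Literature.Analysis.FluidPDE.IsBoundedAncientMildSolution 1 v →
      ContDiffOn ℝ (⊤ : ℕ∞) (Function.uncurry v) (Set.Iio 0 ×ˢ Set.univ) →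
      (∃ C : NNReal, ∀ s < 0, ∫⁻ y, ENNReal.ofReal
          (Literature.Analysis.FluidPDE.frobeniusNormSq (fderiv ℝ (v s) y)) ≤ C) →
      (∀ s < 0, MeasureTheory.MemLp (v s) 6 MeasureTheory.volume) →
      (∫⁻ s in Set.Iio 0, (∫⁻ y, ENNReal.ofReal
          (Literature.Analysis.FluidPDE.frobeniusNormSq (fderiv ℝ (v s) y))) ^ 2) < ⊤) :
    Theses.GaldiLiouvilleGate.GaldiLiouville := by
  intro ν hν U P hprof hU hP hD h0
  obtain ⟨hst, hW, hQ, hDW, h0W⟩ := Tightness.normalise hν hprof hU hP hD h0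
  obtain ⟨h1, h2, h3, h4⟩ := Tightness.steady_hypotheses hst hW hQ hDW h0W
  set W : EuclideanSpace ℝ (Fin 3) → EuclideanSpace ℝ (Fin 3) := ν⁻¹ • U with hWdef
  have hfin := hstub (fun _ => W) h1 h2 h3 h4
  set D : ℝ≥0∞ := ∫⁻ y, ENNReal.ofReal (frobeniusNormSq (fderiv ℝ W y)) with hDdef
  have hfin' : D ^ 2 * volume (Iio (0 : ℝ)) < ⊤ := by
    rw [← setLIntegral_const]
    exact hfin
  rw [Real.volume_Iio] at hfin'
  have hD2 : D ^ 2 = 0 := by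
    by_contra hne
    rw [ENNReal.mul_top hne] at hfin'
    exact lt_irrefl _ hfin'
  have hD0 : D = 0 := pow_eq_zero_iff (n := 2) two_ne_zero |>.1 hD2
  have hW1 : ContDiff ℝ 1 W := hW.of_le (by exact_mod_cast le_top)
  have hzero := Tightness.eq_zero_of_lintegral_frobeniusNormSq_eq_zero hW1 h0W hD0
  exact Tightness.eq_zero_of_inv_smul_eq_zero hν (fun y => by rw [← hWdef]; exact hzero y)

end Summit.NavierStokesRegularity.NavierStokesRegularity.Theorems.ParabolicGaldiLiouville.Birth

end
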